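import Summits.AtomisticToContinuum.Crystallization.Theorems.FrustratedLawDichotomyCapMatchCert
import Summits.AtomisticToContinuum.Crystallization.Theorems.FrustratedLawDichotomyTwoShellRigidityCutTol

/-!
# FrustratedLawDichotomy · crux `AperiodicFrustratedLawGap` (stmt-AtomisticToContinuum-27623) — the NINE FINITE CERTIFICATES with the
# tolerance `θ` as a parameter: `KR2(θ, η) ⟸` finite certificates at `θ`, and the column through the tolerance door (decomp-a2c, hand 2, gen 9)

`kr2Shape_of_finiteCerts` (p822220) is pinned to the registered literals `θ = 1/100`, `η = 1/20`.  All nine certificate statements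
(`LinkCert θ`, `NoTwistCert θ P P'`, `CapMatchCert θ P`, `CappedCert θ η P`) and all reductions are θ-parametric, and so is the tolerance
door (p818040 / `kr2_of_cut_tol`, p820444).  This def-free file chains them:

* `kr2_of_finiteCerts_tol` : the nine certificates at `(θ, η)` ⟹ `KR2(θ, η)` (p818040's `h2` verbatim);
* `frustrationDensityGap_of_price_of_finiteCerts_tol` : `0 < θ ≤ 1/100 → η < 1/20 → Price θ →` nine certificates `→ FDG`;
* `aperiodicFrustratedLawGap_of_price_of_finiteCerts_tol` (crux, given `MuEquilibriumDoor`) and the `θ = 1/200` instance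
  `aperiodicFrustratedLawGap_of_price_of_finiteCerts_200` — the fallback literal is served by the SAME nine finite statements at `1/200`.
`[folklore]`; def-free; no `sorry`.
-/

noncomputable section

namespace Summit.AtomisticToContinuum.Crystallization.Theorems.FrustratedLawDichotomyFiniteCertsTol

open Literature.Geometry.DiscreteGeometry
open Literature.MathematicalPhysics.StatisticalMechanics
open Summit.AtomisticToContinuum.Crystallization.Theorems.ChargedEnergyGapNegative (eStar charged)
open Summit.AtomisticToContinuum.Crystallization.Theorems.FrustratedLawDichotomyCappedRigidityCert (CappedCert)
open Summit.AtomisticToContinuum.Crystallization.Theorems.FrustratedLawDichotomyCappedRigidityCertPatterns (cappedRigidity_of_cert)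
open Summit.AtomisticToContinuum.Crystallization.Theorems.FrustratedLawDichotomyLinkCert (LinkCert linkClassification_of_linkCert)
open Summit.AtomisticToContinuum.Crystallization.Theorems.FrustratedLawDichotomyNoTwistCert (NoTwistCert)
open Summit.AtomisticToContinuum.Crystallization.Theorems.FrustratedLawDichotomyCapMatchCert (CapMatchCert capForcing_of_certs)
open Summit.AtomisticToContinuum.Crystallization.Theorems.FrustratedLawDichotomyTwoShellRigidityCutTol
  (kr2_of_cut_tol frustrationDensityGap_of_price_of_cut_tol aperiodicFrustratedLawGap_of_price_of_cut_tol)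

/-- **The nine finite certificates at `(θ, η)` ⟹ `KR2(θ, η)`** (hypothesis `h2` of the tolerance door p818040, verbatim). [folklore] -/
theorem kr2_of_finiteCerts_tol {θ η : ℝ} (hG : LinkCert θ)
    (hNff : NoTwistCert θ fccKissingPattern fccKissingPattern) (hNfh : NoTwistCert θ fccKissingPattern hcpKissingPattern)
    (hNhf : NoTwistCert θ hcpKissingPattern fccKissingPattern) (hNhh : NoTwistCert θ hcpKissingPattern hcpKissingPattern)
    (hCf : CapMatchCert θ fccKissingPattern) (hCh : CapMatchCert θ hcpKissingPattern)
    (hMf : CappedCert θ η fccKissingPattern) (hMh : CappedCert θ η hcpKissingPattern) :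
    ∀ (N : ℕ) (y : Fin N → EuclideanSpace ℝ (Fin 3)), Function.Injective y → (∀ a b : Fin N, a ≠ b → (7 : ℝ) / 10 ≤ dist (y a) (y b)) → ∀ i : Fin N, Literature.Geometry.DiscreteGeometry.IsChargeFree θ y i → (∀ j : Fin N, (Literature.Geometry.DiscreteGeometry.bondGraph θ y).Adj i j → Literature.Geometry.DiscreteGeometry.IsChargeFree θ y j) → ∃ A : EuclideanSpace ℝ (Fin 3) →ₗᵢ[ℝ] EuclideanSpace ℝ (Fin 3), ((∃ τ : ↥Literature.Geometry.DiscreteGeometry.fccKissingPattern → Fin N, (∀ u : ↥Literature.Geometry.DiscreteGeometry.fccKissingPattern, (Literature.Geometry.DiscreteGeometry.bondGraph θ y).Adj i (τ u)) ∧ (∀ k : Fin N, (Literature.Geometry.DiscreteGeometry.bondGraph θ y).Adj i k → ∃ u : ↥Literature.Geometry.DiscreteGeometry.fccKissingPattern, τ u = k) ∧ (∀ u : ↥Literature.Geometry.DiscreteGeometry.fccKissingPattern, ‖(y (τ u) - y i) - Literature.Geometry.DiscreteGeometry.nearestDist y i • A (u : EuclideanSpace ℝ (Fin 3))‖ ≤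 η * Literature.Geometry.DiscreteGeometry.nearestDist y i)) ∨ (∃ τ : ↥Literature.Geometry.DiscreteGeometry.hcpKissingPattern → Fin N, (∀ u : ↥Literature.Geometry.DiscreteGeometry.hcpKissingPattern, (Literature.Geometry.DiscreteGeometry.bondGraph θ y).Adj i (τ u)) ∧ (∀ k : Fin N, (Literature.Geometry.DiscreteGeometry.bondGraph θ y).Adj i k → ∃ u : ↥Literature.Geometry.DiscreteGeometry.hcpKissingPattern, τ u = k) ∧ (∀ u : ↥Literature.Geometry.DiscreteGeometry.hcpKissingPattern, ‖(y (τ u) - y i) - Literature.Geometry.DiscreteGeometry.nearestDist y i • A (u : EuclideanSpace ℝ (Fin 3))‖ ≤ η * Literature.Geometry.DiscreteGeometry.nearestDist y i))) :=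
  kr2_of_cut_tol (linkClassification_of_linkCert hG) (capForcing_of_certs hNff hNfh hNhf hNhh hCf hCh) (cappedRigidity_of_cert hMf hMh)

/-- **`Price(θ)` ∧ the nine finite certificates at `(θ, η)` ⟹ FDG** for `0 < θ ≤ 1/100`, `η < 1/20`. [folklore] -/
theorem frustrationDensityGap_of_price_of_finiteCerts_tol {θ η : ℝ} (hθ0 : 0 < θ) (hθ1 : θ ≤ 1 / 100) (hη : η < 1 / 20)
    (hprice : ∃ κ : ℝ, 0 < κ ∧ ∀ (N : ℕ) (y : Fin N → EuclideanSpace ℝ (Fin 3)), Function.Injective y → κ * (charged θ y : ℝ) ≤ interactionEnergy lennardJones y - (N : ℝ) * eStar)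
    (hG : LinkCert θ)
    (hNff : NoTwistCert θ fccKissingPattern fccKissingPattern) (hNfh : NoTwistCert θ fccKissingPattern hcpKissingPattern)
    (hNhf : NoTwistCert θ hcpKissingPattern fccKissingPattern) (hNhh : NoTwistCert θ hcpKissingPattern hcpKissingPattern)
    (hCf : CapMatchCert θ fccKissingPattern) (hCh : CapMatchCert θ hcpKissingPattern)
    (hMf : CappedCert θ η fccKissingPattern) (hMh : CappedCert θ η hcpKissingPattern) :
    ∃ κ : ℝ, 0 < κ ∧ ∃ C : ℝ, ∀ (N : ℕ) (y : Fin N → EuclideanSpace ℝ (Fin 3)), Function.Injective y → (∀ a b : Fin N, a ≠ b → (7 : ℝ) / 10 ≤ dist (y a) (y b)) → κ * N - C * (Nat.card {i : Fin N // ∃ (d η γ : ℝ) (A : EuclideanSpace ℝ (Fin 3) →ₗᵢ[ℝ] EuclideanSpace ℝ (Fin 3)), (∃ t : ↥Literature.Geometry.DiscreteGeometry.fccKissingPattern → EuclideanSpace ℝ (Fin 3), 0 < d ∧ 0 < γ ∧ η < 1 / 20 ∧ (∀ u : ↥Literature.Geometry.DiscreteGeometry.fccKissingPattern, t u ∈ (Set.range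 y) ∧ ‖(t u - (y i)) - d • A (u : EuclideanSpace ℝ (Fin 3))‖ ≤ η * d) ∧ (∀ s : EuclideanSpace ℝ (Fin 3), s ∈ (Set.range y) → s ≠ (y i) → d ≤ dist s (y i)) ∧ (∃ s : EuclideanSpace ℝ (Fin 3), s ∈ (Set.range y) ∧ s ≠ (y i) ∧ dist s (y i) ≤ d) ∧ (∀ s : EuclideanSpace ℝ (Fin 3), s ∈ (Set.range y) → s ≠ (y i) → dist s (y i) < 13 / 10 * d + γ → dist s (y i) ≤ 13 / 10 * d - γ ∧ s ∈ Set.range t)) ∨ (∃ t : ↥Literature.Geometry.DiscreteGeometry.hcpKissingPattern → EuclideanSpace ℝ (Fin 3), 0 < d ∧ 0 < γ ∧ η < 1 / 20 ∧ (∀ u : ↥Literature.Geometry.DiscreteGeometry.hcpKissingPattern, t u ∈ (Set.range y) ∧ ‖(t u - (y i)) - d • A (u : EuclideanSpace ℝ (Fin 3))‖ ≤ η * d) ∧ (∀ s : EuclideanSpace ℝ (Fin 3), s ∈ (Set.range y) → s ≠ (y i) → d ≤ dist s (y i)) ∧ (∃ s : EuclideanSpace ℝ (Fin 3), s ∈ (Set.range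 y) ∧ s ≠ (y i) ∧ dist s (y i) ≤ d) ∧ (∀ s : EuclideanSpace ℝ (Fin 3), s ∈ (Set.range y) → s ≠ (y i) → dist s (y i) < 13 / 10 * d + γ → dist s (y i) ≤ 13 / 10 * d - γ ∧ s ∈ Set.range t))} : ℝ) ≤ Literature.MathematicalPhysics.StatisticalMechanics.interactionEnergy Literature.MathematicalPhysics.StatisticalMechanics.lennardJones y - N * (⨅ Q : Literature.MathematicalPhysics.StatisticalMechanics.PeriodicConfiguration 3, Q.energyPerParticle Literature.MathematicalPhysics.StatisticalMechanics.lennardJones) :=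
  frustrationDensityGap_of_price_of_cut_tol hθ0 hθ1 hη hprice (linkClassification_of_linkCert hG)
    (capForcing_of_certs hNff hNfh hNhf hNhh hCf hCh) (cappedRigidity_of_cert hMf hMh)

/-- **`AperiodicFrustratedLawGap` (crux of item 27623) BY NAME** from `MuEquilibriumDoor ∧ Price(θ)` and the nine finite certificates at
`(θ, η)`, `0 < θ ≤ 1/100`, `η < 1/20`. [folklore] -/
theorem aperiodicFrustratedLawGap_of_price_of_finiteCerts_tol {θ η : ℝ} (hθ0 : 0 < θ) (hθ1 : θ ≤ 1 / 100) (hη : η < 1 / 20)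
    (hDoor : Summit.AtomisticToContinuum.Crystallization.Theses.GrainCoreNetworkSplit.MuEquilibriumDoor)
    (hprice : ∃ κ : ℝ, 0 < κ ∧ ∀ (N : ℕ) (y : Fin N → EuclideanSpace ℝ (Fin 3)), Function.Injective y → κ * (charged θ y : ℝ) ≤ interactionEnergy lennardJones y - (N : ℝ) * eStar)
    (hG : LinkCert θ)
    (hNff : NoTwistCert θ fccKissingPattern fccKissingPattern) (hNfh : NoTwistCert θ fccKissingPattern hcpKissingPattern)
    (hNhf : NoTwistCert θ hcpKissingPattern fccKissingPattern) (hNhh : NoTwistCert θ hcpKissingPattern hcpKissingPattern)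
    (hCf : CapMatchCert θ fccKissingPattern) (hCh : CapMatchCert θ hcpKissingPattern)
    (hMf : CappedCert θ η fccKissingPattern) (hMh : CappedCert θ η hcpKissingPattern) :
    Summit.AtomisticToContinuum.Crystallization.Theses.FrustratedLawDichotomy.AperiodicFrustratedLawGap :=
  aperiodicFrustratedLawGap_of_price_of_cut_tol hθ0 hθ1 hη hDoor hprice (linkClassification_of_linkCert hG)
    (capForcing_of_certs hNff hNfh hNhf hNhh hCf hCh) (cappedRigidity_of_cert hMf hMh)

/-- **The fallback literal `θ = 1/200`, by name**: `MuEquilibriumDoor ∧ Price(1/200)` and the nine finite certificates at `θ = 1/200`,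
`η < 1/20` ⟹ `AperiodicFrustratedLawGap`. [folklore] -/
theorem aperiodicFrustratedLawGap_of_price_of_finiteCerts_200 {η : ℝ} (hη : η < 1 / 20)
    (hDoor : Summit.AtomisticToContinuum.Crystallization.Theses.GrainCoreNetworkSplit.MuEquilibriumDoor)
    (hprice : ∃ κ : ℝ, 0 < κ ∧ ∀ (N : ℕ) (y : Fin N → EuclideanSpace ℝ (Fin 3)), Function.Injective y → κ * (charged (1 / 200 : ℝ) y : ℝ) ≤ interactionEnergy lennardJones y - (N : ℝ) * eStar)
    (hG : LinkCert (1 / 200))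
    (hNff : NoTwistCert (1 / 200) fccKissingPattern fccKissingPattern) (hNfh : NoTwistCert (1 / 200) fccKissingPattern hcpKissingPattern)
    (hNhf : NoTwistCert (1 / 200) hcpKissingPattern fccKissingPattern) (hNhh : NoTwistCert (1 / 200) hcpKissingPattern hcpKissingPattern)
    (hCf : CapMatchCert (1 / 200) fccKissingPattern) (hCh : CapMatchCert (1 / 200) hcpKissingPattern)
    (hMf : CappedCert (1 / 200) η fccKissingPattern) (hMh : CappedCert (1 / 200) η hcpKissingPattern) :
    Summit.AtomisticToContinuum.Crystallization.Theses.FrustratedLawDichotomy.AperiodicFrustratedLawGap :=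
  aperiodicFrustratedLawGap_of_price_of_finiteCerts_tol (by norm_num) (by norm_num) hη hDoor hprice hG hNff hNfh hNhf hNhh hCf hCh hMf hMh

end Summit.AtomisticToContinuum.Crystallization.Theorems.FrustratedLawDichotomyFiniteCertsTol

end
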